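import Literature.MathematicalPhysics.QuantumFieldTheory.Balaban1983to89.B9Thm312WholeBlocksRegular
import Literature.MathematicalPhysics.QuantumFieldTheory.Balaban1983to89.B9Thm312WholeMembersRegular

/-!
# `Balaban1983to89.B9Thm312WholeLeafBlocksRegular` — [B9] Theorem 3.12: THE HÖLDER BLOCK (3.43)–(3.45) OF A ∈ {G, G₁} AND THE H-WORDS OF (3.126)∕(3.129)∕(3.133) AT ONE
# MEMBER, FROM THE RIGHT ENTRIES IN A REGULAR STATE — the S-twins of `B9Thm312WholeBlocksPairMB.holder_of_step_pairMB` and of the H-block of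
# `B9Thm312WholeLeafRelHZ` (first resolvent form only; LOCATED-U8′)

T. Bałaban, *Propagators for lattice gauge theories in a background field*, Commun. Math. Phys. **99** (1985) 389–434 [`Balaban1985BackgroundPropagators`,
"B9"]; [4] = T. Bałaban, *Propagators and renormalization transformations for lattice gauge theories. II*, Commun. Math. Phys. **96** (1984) 223–250
[`Balaban1984PropagatorsII`].  statement-level skeleton of published theorems with citation tags; proofs where landed; nothing here is a claim about the
Yang–Mills mass gap.  Sequel of `B9Thm312WholeMembersRegular`, `B9Thm312WholeBlocksRegular` (g27).

THE PRINT.  Thm 3.12 p. 423; (3.43)–(3.45) p. 398; (3.126) p. 420, (3.129) p. 421, (3.132)–(3.133) p. 422; p. 423: derivatives of Δ′_π + Δ⁽²⁾_π applied to the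
neighbouring propagators; [4] (2.54), Lemma 2.1 (2.60)–(2.61) p. 234.

THE POINT (dag-n06-l LOCATED-U8′).  The per-member blocks of the row-20 leaf, with the raw-state one-step objects replaced by: the right entries A, A∇\*_U, A∇\*_{U,μ},
H = A∘(Q\*C) IN two free state classes 𝔖₂ (dimension 2), 𝔖₁ (dimension 1) and the one-step left-form members OUT OF them.
* §1 ★★ `holder_of_state_pairM` — `B9.Ineq343_345 K …` from the right entries `A : 𝔠⁽⁰⁾ → 𝔖₂`, `A∇\* : 𝔠_Y^{(0)} → 𝔖₁`, `A∇\*_μ : bHX ε → 𝔖₁`, the probes of the left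
  steps out of 𝔖₂ ∕ 𝔖₁, Theorem 3.3's `h43L h43R h44m h45m` and the readings (`B9Thm312WholeMembersRegular` + `ineq343_345_of_majorants_pairM`), all four families
  at the rate ρ_f ≦ ρ;
* §3 ★★ `blocks_of_state_pairM` — both blocks and the three sup members of A at once (+ `l2Block_of_members_pairM`);
* §2 ★★ `hwords_of_state` — H = A∘(Q\*C) read into 𝔠⁽²⁾, ∇_UH by the first resolvent form, and the Hölder member of (3.133) on the neighbourhood, from `H : 𝔠_Z⁽²⁾ → 𝔖₂`
  (`B9Thm312WholeBlocksRegular.H_entry0_of_stateS` upstream), the sup reading, the left step and its Φ^Y_β-probe out of 𝔖₂, the letters `dgQs`, C, `pQ`.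
HONEST SCOPE.  Bookkeeping; everything of printed type enters as a HYPOTHESIS; nothing of [B9] asserted; NOT a node discharge; COUNT-NEUTRAL; one finite lattice at a time —
nothing continuum ∕ OS ∕ mass gap.  Cell `pub-ymgap` (HUMAN RULING D-0062), Track A node N06 [B9], bundle F7 row 20, seat `pub-ymgap-dag-n06-l` (g27), 2026-08-29.  NEW file.
-/

namespace Literature.MathematicalPhysics.QuantumFieldTheory.Balaban1983to89.B9Thm312WholeLeafBlocksRegular

open Literature.MathematicalPhysics.QuantumFieldTheory.Balaban1983to89
open Finset B6RandomWalk B6RandomWalkHom B9Thm34Ext B9Thm37Glue B9Thm37GlueCor36 B11SectG B9SectDSup B9SectDL2Decay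
open B9Thm37AllNorms B9Thm37AllNormsInstances B9FromB6 B9FromB6ModelSignsOn B9SectBStepWhole B9Thm312Whole B9Thm312WholeLeaf
open B9Thm312WholeLeft B9RWSums343Holder B9RWSums346Schur B9RWSumsReadsRel B9RWSumsReadsNbr B9Ineq347 B9Thm312WholeClasses
open B9Thm312WholeHolder B9Thm312WholeL2 B9Thm312WholeBlocksRel B9RWSums346SecondDiff B9Thm312WholeBlocksNbr B9Thm312WholeBlocksNbrRec
open B9RWSums344InputFam B9Thm312WholeDir B9Thm312WholeBlocksPairM
open B9Thm312WholeH B9CoRealizesHRel B9Thm312WholeHHolder B9Thm312WholeHHolderNbr B9Thm312WholeHZ B9Thm312WholeStepRegular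
open B9Thm312WholeMembersRegular B9Thm312WholeBlocksRegular

noncomputable section

variable {g : B9.Geometry} {B : B9.Backgrounds} {X Y Z W PX PY P : Type}
variable [Fintype X] [Fintype Y] [Fintype Z] [Fintype PX] [Fintype PY] [Fintype P] [Fintype g.Site] [DecidableEq g.Site]
variable {R₀ : ℝ} {H₀ : Prop}

/-! ## §1 The Hölder block (3.43)–(3.45) from the right entries in the state -/

omit [Fintype Z] in
/-- ★★ **THEOREM 3.12 — THE HÖLDER BLOCK (3.43)–(3.45) ON THE PAIR FAMILY FROM THE REGULAR STATE** (the S-twin of `holder_of_step_pairMB`).  Data at U: A = G₀ + G₀TA; the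
right entries `A : 𝔠⁽⁰⁾ → 𝔖₂` (A′e^{−ρ_A d}), `A∇\* : 𝔠_Y^{(0)} → 𝔖₁` (A′e^{−ρ_A d}), `A∇\*_{U,μ} : bHX ε → 𝔖₁` (A_I(ε)e^{−ρ_A d}, every ε > 0); the probes of the left steps
`Φ^Y_β∇_UG₀T : 𝔖₂ → 𝔠_{PY}^{(β−1)}`, `Φ^X_βG₀T : 𝔖₁ → 𝔠_{PX}^{(β−1)}`, `Φ^X_β∇_νG₀T : 𝔖₁ → 𝔠_{PX}^{(β)}` (θ_H(β)) and `∇_νG₀T : 𝔖₁ → 𝔠^{(0)}` (θ′); Theorem 3.3's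
`h43L h43R h44m h45m` (`Thm33G0Dir`); κ(𝔖₂), κ(𝔖₁) ≦ κ̄; the co-readings `H1ReadsNbr`, `InputReadsFam`.  Provisos: 0 ≦ ρ_f ≦ ρ ≦ min(δ₀, ρ_A), ρ + σ ≦ δ_K.  Conclusion:
`B9.Ineq343_345 K (β ↦ m·CL·e^{rρ_f}(B_h β + κ̄θ_H(β)A′c)) (ε ↦ e^{rρ_f}(B_i ε + κ̄θ′A_I(ε)c)) ((ε,β) ↦ CL·e^{rρ_f}(B_i2 ε β + κ̄θ_H(β)A_I(β+ε)c)) ρ_f U`.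
[cite: Balaban1985BackgroundPropagators, Thm 3.12 p.423 + Thm 3.3 p.399 + (3.43)–(3.45) p.398 + (3.39)–(3.40) p.397 + (3.130) p.421 + (3.138) p.423; Balaban1984PropagatorsII, (2.51)–(2.54) pp.232–233 + Lemma 2.1 (2.61) p.234] -/
theorem holder_of_state_pairM (hG : GeoOK g) {K : B9.KernelFamily g B} {U : B.Cfg} (𝔬 : Ops g B X Y Z W)
    (𝔭 : HolderProbes g B X Y PX PY) (Dd Dds : B.Cfg → P → Module.End ℝ (X → ℝ)) (bHX : ℝ → BlockNorm (toB6 g R₀ H₀) (X → ℝ))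
    (Rel : g.Site → g.Site → Prop) [DecidableRel Rel] (ev : g.Loc → X → ℝ) (evY : g.Loc → Y → ℝ)
    {𝔖₂ 𝔖₁ : BlockNorm (toB6 g R₀ H₀) (X → ℝ)} {A T : Module.End ℝ (X → ℝ)} {m : ℕ}
    {r CL θ' A' κb B₀ δ₀ δK ρ ρA ρf σ c : ℝ} {θH Bh Bi AI : ℝ → ℝ} {Bi2 : ℝ → ℝ → ℝ}
    (hrow : RowSum (toB6 g R₀ H₀) σ c) (hc : 0 ≤ c)
    (hθ' : 0 ≤ θ') (hθH : ∀ β, 0 ≤ β → β < 1 → 0 ≤ θH β) (hA' : 0 ≤ A') (hAI : ∀ ε, 0 < ε → 0 ≤ AI ε)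
    (hκ2 : 𝔖₂.κ ≤ κb) (hκ1 : 𝔖₁.κ ≤ κb)
    (hρ : 0 ≤ ρ) (hρS : ρ ≤ δ₀) (hρA : ρ ≤ ρA) (hρδ : ρ + σ ≤ δK) (hρf : 0 ≤ ρf) (hρfρ : ρf ≤ ρ)
    (hBh : ∀ β, 0 ≤ β → β < 1 → 0 ≤ Bh β) (hBi : ∀ ε, 0 < ε → ε ≤ 1 → 0 ≤ Bi ε)
    (hBi2 : ∀ ε β, 0 < ε → ε ≤ 1 → 0 ≤ β → β < 1 → 0 ≤ Bi2 ε β)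
    (hfix : A = 𝔬.G0 U + 𝔬.G0 U ∘ₗ T ∘ₗ A)
    (hH0 : Thm33G0Dir 𝔬 𝔭 Dd Dds R₀ H₀ bHX B₀ Bh Bi Bi2 δ₀ U)
    (rA : HasMaj (cNorm R₀ H₀ 𝔬.blk hG.lenle 0) 𝔖₂ A (fun a b => A' * Real.exp (-(ρA * g.dist a b))))
    (rADs : HasMaj (cNormR R₀ H₀ 𝔬.blkY hG.lenle 0) 𝔖₁ (A ∘ₗ 𝔬.Dstar U) (fun a b => A' * Real.exp (-(ρA * g.dist a b))))
    (rADds : ∀ (μ : P) (ε : ℝ), 0 < ε → HasMaj (bHX ε) 𝔖₁ (A ∘ₗ Dds U μ) (fun a b => AI ε * Real.exp (-(ρA * g.dist a b))))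
    (hKY : ∀ β : ℝ, 0 ≤ β → β < 1 → HasMaj 𝔖₂ (cNormR R₀ H₀ 𝔭.blkPY hG.lenle (β - 1)) ((𝔭.ΦY U β ∘ₗ 𝔬.D U ∘ₗ 𝔬.G0 U) ∘ₗ T)
      (fun a b => θH β * Real.exp (-(δK * g.dist a b))))
    (hKDd : ∀ ν : P, HasMaj 𝔖₁ (cNormR R₀ H₀ 𝔬.blk hG.lenle 0) (Dd U ν ∘ₗ 𝔬.G0 U ∘ₗ T) (fun a b => θ' * Real.exp (-(δK * g.dist a b))))
    (hKX : ∀ β : ℝ, 0 ≤ β → β < 1 → HasMaj 𝔖₁ (cNormR R₀ H₀ 𝔭.blkPX hG.lenle (β - 1)) ((𝔭.ΦX U β ∘ₗ 𝔬.G0 U) ∘ₗ T)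
      (fun a b => θH β * Real.exp (-(δK * g.dist a b))))
    (hKXd : ∀ (ν : P) (β : ℝ), 0 ≤ β → β < 1 → HasMaj 𝔖₁ (cNormR R₀ H₀ 𝔭.blkPX hG.lenle β) ((𝔭.ΦX U β ∘ₗ Dd U ν ∘ₗ 𝔬.G0 U) ∘ₗ T)
      (fun a b => θH β * Real.exp (-(δK * g.dist a b))))
    (hRd₂ : ∀ a b b', Rel b b' → g.dist a b = g.dist a b')
    (hmult : ∀ y' : g.Site, (Finset.univ.filter (fun y'' => Rel y'' y')).card ≤ m)
    (hCL1 : 1 ≤ CL) (hCL : ∀ a a' : g.Site, g.dist a a' ≤ r → g.len a ≤ CL * g.len a')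
    (hH1 : H1ReadsNbr K U 𝔭 Rel r 𝔬.blk 𝔬.blkY ev evY (𝔬.D U ∘ₗ A) (A ∘ₗ 𝔬.Dstar U))
    (hIR : InputReadsFam K U bHX r (𝔬.blk ∘ Prod.fst) (𝔭.blkPX ∘ Prod.fst) (fun β => sliceProbe (𝔭.ΦX U β)) ev
      (familyOp (fun q : P × P => Dd U q.1 ∘ₗ (A ∘ₗ Dds U q.2)))) :
    B9.Ineq343_345 K (fun β => m * CL * Real.exp (r * ρf) * (Bh β + κb * θH β * A' * c))
      (fun ε => Real.exp (r * ρf) * (Bi ε + κb * θ' * AI ε * c))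
      (fun ε β => CL * Real.exp (r * ρf) * (Bi2 ε β + κb * θH β * AI (β + ε) * c)) ρf U := by
  have hκ20 : 0 ≤ 𝔖₂.κ := 𝔖₂.κ_nonneg
  have hκ10 : 0 ≤ 𝔖₁.κ := 𝔖₁.κ_nonneg
  have hκb0 : 0 ≤ κb := hκ20.trans hκ2
  have hexpf : ∀ y y' : g.Site, Real.exp (-(ρ * g.dist y y')) ≤ Real.exp (-(ρf * g.dist y y')) := fun y y' =>
    Real.exp_le_exp.mpr (neg_le_neg (mul_le_mul_of_nonneg_right hρfρ (hG.dnn y y')))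
  have hBhu0 : ∀ β, 0 ≤ β → β < 1 → 0 ≤ Bh β + κb * θH β * A' * c := fun β h0 h1 =>
    add_nonneg (hBh β h0 h1) (mul_nonneg (mul_nonneg (mul_nonneg hκb0 (hθH β h0 h1)) hA') hc)
  -- (3.43), left and right, weakened to κ̄ and the rate ρ_f
  have h43L : ∀ β, 0 ≤ β → β < 1 → HasMajorantHom (g := toB6 g R₀ H₀) 𝔬.blk 𝔭.blkPY (𝔭.ΦY U β ∘ₗ (𝔬.D U ∘ₗ A))
      (fun (a b : g.Site) => (Bh β + κb * θH β * A' * c) * g.len a ^ (1 - β) * Real.exp (-(ρf * g.dist a b))) := by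
    intro β h0 h1
    have h := probe43L_of_stateS hG 𝔭 hrow hc (hθH β h0 h1) (hBh β h0 h1) hA' hρ hρS hρA hρδ (hH0.h43L β h0 h1) (hKY β h0 h1) rA hfix
    have h3 : Bh β + 𝔖₂.κ * θH β * A' * c ≤ Bh β + κb * θH β * A' * c := by
      have := mul_le_mul_of_nonneg_right (mul_le_mul_of_nonneg_right (mul_le_mul_of_nonneg_right hκ2 (hθH β h0 h1)) hA') hc
      linarith
    exact hasMajorantHom_mono (g := toB6 g R₀ H₀) 𝔬.blk 𝔭.blkPY h fun a b =>
      mul_le_mul (mul_le_mul_of_nonneg_right h3 (Real.rpow_nonneg (hG.lenle a) _)) (hexpf a b) (Real.exp_nonneg _)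
        (mul_nonneg (hBhu0 β h0 h1) (Real.rpow_nonneg (hG.lenle a) _))
  have h43R : ∀ β, 0 ≤ β → β < 1 → HasMajorantHom (g := toB6 g R₀ H₀) 𝔬.blkY 𝔭.blkPX (𝔭.ΦX U β ∘ₗ (A ∘ₗ 𝔬.Dstar U))
      (fun (a b : g.Site) => (Bh β + κb * θH β * A' * c) * g.len a ^ (1 - β) * Real.exp (-(ρf * g.dist a b))) := by
    intro β h0 h1
    have h := probe43R_of_stateS hG 𝔭 hrow hc (hθH β h0 h1) (hBh β h0 h1) hA' hρ hρS hρA hρδ (hH0.h43R β h0 h1) (hKX β h0 h1) rADs hfix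
    have h3 : Bh β + 𝔖₁.κ * θH β * A' * c ≤ Bh β + κb * θH β * A' * c := by
      have := mul_le_mul_of_nonneg_right (mul_le_mul_of_nonneg_right (mul_le_mul_of_nonneg_right hκ1 (hθH β h0 h1)) hA') hc
      linarith
    exact hasMajorantHom_mono (g := toB6 g R₀ H₀) 𝔬.blkY 𝔭.blkPX h fun a b =>
      mul_le_mul (mul_le_mul_of_nonneg_right h3 (Real.rpow_nonneg (hG.lenle a) _)) (hexpf a b) (Real.exp_nonneg _)
        (mul_nonneg (hBhu0 β h0 h1) (Real.rpow_nonneg (hG.lenle a) _))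
  -- (3.44) and (3.45) on the pair family
  have h44 : ∀ ε, 0 < ε → ε ≤ 1 → HasMaj (bHX ε) (BlockNorm.ofBlocks (toB6 g R₀ H₀) (𝔬.blk ∘ Prod.fst))
      (familyOp (fun q : P × P => Dd U q.1 ∘ₗ (A ∘ₗ Dds U q.2))) (fun (a b : g.Site) => (Bi ε + κb * θ' * AI ε * c) * Real.exp (-(ρf * g.dist a b))) := by
    intro ε hε hε1
    have h := input44_family_of_stateS hG hrow hθ' (hBi ε hε hε1) (hAI ε hε) hρ hρS hρA hρδ (fun q => hH0.h44m q ε hε hε1) hKDd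
      (fun μ => rADds μ ε hε) hfix
    have h30 : 0 ≤ Bi ε + 𝔖₁.κ * θ' * AI ε * c := add_nonneg (hBi ε hε hε1) (mul_nonneg (mul_nonneg (mul_nonneg hκ10 hθ') (hAI ε hε)) hc)
    have h3 : Bi ε + 𝔖₁.κ * θ' * AI ε * c ≤ Bi ε + κb * θ' * AI ε * c := by
      have := mul_le_mul_of_nonneg_right (mul_le_mul_of_nonneg_right (mul_le_mul_of_nonneg_right hκ1 hθ') (hAI ε hε)) hc
      linarith
    exact h.mono fun a b => mul_le_mul h3 (hexpf a b) (Real.exp_nonneg _) (h30.trans h3)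
  have h45 : ∀ ε β, 0 < ε → ε ≤ 1 → 0 ≤ β → β < 1 → HasMaj (bHX (β + ε)) (BlockNorm.ofBlocks (toB6 g R₀ H₀) (𝔭.blkPX ∘ Prod.fst))
      (sliceProbe (𝔭.ΦX U β) ∘ₗ familyOp (fun q : P × P => Dd U q.1 ∘ₗ (A ∘ₗ Dds U q.2)))
      (fun (a b : g.Site) => (Bi2 ε β + κb * θH β * AI (β + ε) * c) * g.len a ^ (-β) * Real.exp (-(ρf * g.dist a b))) := by
    intro ε β hε hε1 h0 h1
    have hβε : 0 < β + ε := by linarith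
    have h := input45_family_of_stateS hG hrow (hθH β h0 h1) (hBi2 ε β hε hε1 h0 h1) (hAI (β + ε) hβε) hρ hρS hρA hρδ
      (fun q => hH0.h45m q ε β hε hε1 h0 h1) (fun ν => hKXd ν β h0 h1) (fun μ => rADds μ (β + ε) hβε) hfix
    have h30 : 0 ≤ Bi2 ε β + 𝔖₁.κ * θH β * AI (β + ε) * c :=
      add_nonneg (hBi2 ε β hε hε1 h0 h1) (mul_nonneg (mul_nonneg (mul_nonneg hκ10 (hθH β h0 h1)) (hAI (β + ε) hβε)) hc)
    have h3 : Bi2 ε β + 𝔖₁.κ * θH β * AI (β + ε) * c ≤ Bi2 ε β + κb * θH β * AI (β + ε) * c := by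
      have := mul_le_mul_of_nonneg_right (mul_le_mul_of_nonneg_right (mul_le_mul_of_nonneg_right hκ1 (hθH β h0 h1)) (hAI (β + ε) hβε)) hc
      linarith
    exact h.mono fun a b => mul_le_mul (mul_le_mul_of_nonneg_right h3 (Real.rpow_nonneg (hG.lenle a) _)) (hexpf a b) (Real.exp_nonneg _)
      (mul_nonneg (h30.trans h3) (Real.rpow_nonneg (hG.lenle a) _))
  exact ineq343_345_of_majorants_pairM (R := R₀) (H := H₀) hG 𝔭 bHX hRd₂ hmult hCL1 hCL hBhu0
    (fun ε hε hε1 => add_nonneg (hBi ε hε hε1) (mul_nonneg (mul_nonneg (mul_nonneg hκb0 hθ') (hAI ε hε)) hc))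
    (fun ε β hε hε1 h0 h1 => add_nonneg (hBi2 ε β hε hε1 h0 h1)
      (mul_nonneg (mul_nonneg (mul_nonneg hκb0 (hθH β h0 h1)) (hAI (β + ε) (by linarith))) hc))
    hρf h43L h43R h44 h45 hH1 hIR

/-! ## §2 The H-words of (3.126) ∕ (3.129) and the Hölder member of (3.133) from H in the state -/

omit [Fintype PX] [Fintype P] [DecidableEq g.Site] in
/-- ★★ **THE H-WORDS AT ONE MEMBER FROM H IN THE REGULAR STATE** (the S-twin of the H-block of `thm312Printed_of_stepRelHZ` + `hkh_of_step_nbrZ`): from `H : 𝔠_Z⁽²⁾ → 𝔖₂`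
(K_He^{−ρ_H d}, ρ_H ≧ ρ — `H_entry0_of_stateS`), the sup reading `id : 𝔖₂ → 𝔠^{(−2)}` (C_R), the left step `∇_UG₀T : 𝔖₂ → 𝔠_Y⁽¹⁾` (θ′), its probe `Φ^Y_β∇_UG₀T` (θ_H(β)), the
letters `∇_UG₀Q\* : bZ → 𝔠_Y⁽¹⁾`, `C : 𝔠_Z⁽²⁾ → bZ` (B₃, `bZ.κ = 1`), `Φ^Y_β∇_UG₀Q\* : bZ → 𝔠_P^{(β−1)}` (B_q(β)), the transfer `hST` and the co-reading `CoReadsHHolderNbr`: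
(i) `H : 𝔠_Z⁽²⁾ → 𝔠⁽²⁾` with κ_S·C_R·K_H·c·e^{−ρd}; (ii) `∇_UH` with (B₃²c + κ_S·θ′·K_H·c)·e^{−ρd}; (iii) the Hölder member of (3.133) with constant
CL²·e^{r(1−α)ρ}·(B_qB₃c + κ_S·θ_H·K_H·c)·Λ at the rate (1 − α)ρ.
[cite: Balaban1985BackgroundPropagators, (3.126) p.420 + (3.129) p.421 + (3.132)–(3.133) p.422 + (3.130) p.421 + Thm 3.12 p.423; Balaban1984PropagatorsII, (2.54) p.233 + Lemma 2.1 (2.60)–(2.61) p.234] -/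
theorem hwords_of_state (hG : GeoOK g) {Hk : B9.HKernel g B} {U : B.Cfg} {d : ℕ} (𝔬 : Ops g B X Y Z W) (𝔭 : HolderProbes g B X Y PX PY)
    {bZ : BlockNorm (toB6 g R₀ H₀) (Z → ℝ)} {𝔖₂ : BlockNorm (toB6 g R₀ H₀) (X → ℝ)} {A T : Module.End ℝ (X → ℝ)} {Cop : Module.End ℝ (Z → ℝ)}
    {Hop : (Z → ℝ) →ₗ[ℝ] (X → ℝ)} {r CL θ' θH KH CR B₃ Bq β δ₃ δK rR ρ ρH α Λ σ c : ℝ}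
    (hrow : RowSum (toB6 g R₀ H₀) σ c) (hκ : bZ.κ = 1) (hc : 0 ≤ c) (hθ' : 0 ≤ θ') (hθH : 0 ≤ θH) (hKH : 0 ≤ KH) (hCR : 0 ≤ CR) (hB₃ : 0 ≤ B₃) (hBq : 0 ≤ Bq)
    (hΛ : 0 ≤ Λ) (hσ : 0 ≤ σ) (hρ : 0 ≤ ρ) (hρH : ρ ≤ ρH) (hρR : ρ + σ ≤ rR) (hρ₃ : ρ + σ + σ ≤ δ₃) (hρδ : ρ + σ ≤ δK) (hα1 : α ≤ 1) (hβ0 : 0 ≤ β) (hβ1 : β < 1)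
    (hHop : Hop = A ∘ₗ (𝔬.Qstar U ∘ₗ Cop)) (hfix : A = 𝔬.G0 U + 𝔬.G0 U ∘ₗ T ∘ₗ A)
    (rH : HasMaj (cNorm R₀ H₀ 𝔬.blkZ hG.lenle 2) 𝔖₂ Hop (fun a b => KH * Real.exp (-(ρH * g.dist a b))))
    (hRd : HasMaj 𝔖₂ (cNormR R₀ H₀ 𝔬.blk hG.lenle (-2)) LinearMap.id (fun a b => CR * Real.exp (-(rR * g.dist a b))))
    (hKD : HasMaj 𝔖₂ (cNorm R₀ H₀ 𝔬.blkY hG.lenle 1) (𝔬.D U ∘ₗ 𝔬.G0 U ∘ₗ T) (fun a b => θ' * Real.exp (-(δK * g.dist a b))))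
    (hKY : HasMaj 𝔖₂ (cNormR R₀ H₀ 𝔭.blkPY hG.lenle (β - 1)) ((𝔭.ΦY U β ∘ₗ 𝔬.D U ∘ₗ 𝔬.G0 U) ∘ₗ T) (fun a b => θH * Real.exp (-(δK * g.dist a b))))
    (hDQs : HasMaj bZ (cNorm R₀ H₀ 𝔬.blkY hG.lenle 1) (𝔬.D U ∘ₗ 𝔬.G0 U ∘ₗ 𝔬.Qstar U) (fun a b => B₃ * Real.exp (-(δ₃ * g.dist a b))))
    (hCop : HasMaj (cNorm R₀ H₀ 𝔬.blkZ hG.lenle 2) bZ Cop (fun a b => B₃ * Real.exp (-(δ₃ * g.dist a b))))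
    (hpQ : HasMaj bZ (cNormR R₀ H₀ 𝔭.blkPY hG.lenle (β - 1)) ((𝔭.ΦY U β ∘ₗ 𝔬.D U ∘ₗ 𝔬.G0 U) ∘ₗ 𝔬.Qstar U) (fun a b => Bq * Real.exp (-(δ₃ * g.dist a b))))
    (hC : CoReadsHHolderNbr Hk U d 𝔭 r 𝔬.blkZ (𝔬.D U ∘ₗ Hop))
    (hCL1 : 1 ≤ CL) (hCL : ∀ a a' : g.Site, g.dist a a' ≤ r → g.len a ≤ CL * g.len a')
    (hST : ScaleTransfer g ρ α Λ (fun y => g.len y ^ (2 : ℝ))) :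
    HasMaj (cNorm R₀ H₀ 𝔬.blkZ hG.lenle 2) (cNorm R₀ H₀ 𝔬.blk hG.lenle 2) Hop (fun a b => 𝔖₂.κ * CR * KH * c * Real.exp (-(ρ * g.dist a b))) ∧
      HasMaj (cNorm R₀ H₀ 𝔬.blkZ hG.lenle 2) (cNorm R₀ H₀ 𝔬.blkY hG.lenle 1) (𝔬.D U ∘ₗ Hop)
        (fun a b => (B₃ * B₃ * c + 𝔖₂.κ * θ' * KH * c) * Real.exp (-(ρ * g.dist a b))) ∧
      ∀ (ζ : g.Cut) (y y' : g.Site), g.cutInT ζ y →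
        Hk.h U β ζ y' ≤ (CL ^ 2 * Real.exp (r * ((1 - α) * ρ)) * ((Bq * B₃ * c + 𝔖₂.κ * θH * KH * c) * Λ)) * g.cutH β ζ *
          (g.len y) ^ (-(1 + β)) * (g.len y') ^ (-(d : ℝ)) * Real.exp (-((1 - α) * ρ * g.dist y y')) := by
  have htri : Triangle254 (toB6 g R₀ H₀) := fun a b c => hG.tri a b c
  have hB33 : 0 ≤ B₃ * B₃ * c := mul_nonneg (mul_nonneg hB₃ hB₃) hc
  have rHρ : HasMaj (cNorm R₀ H₀ 𝔬.blkZ hG.lenle 2) 𝔖₂ Hop (fun a b => KH * Real.exp (-(ρ * g.dist a b))) :=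
    rH.of_rate_le hG.dnn hKH hρH
  -- (i) H read back into 𝔠⁽²⁾
  have hH0 := H_read_of_stateS hG hrow hKH hCR hρ hρH hρR rH hRd
  -- (ii) ∇_UH = ∇_UG₀(Q\*C) + (∇_UG₀T)H
  have hρ₁0 : 0 ≤ ρ + σ := add_nonneg hρ hσ
  have hEF : HasMaj (cNorm R₀ H₀ 𝔬.blkZ hG.lenle 2) (cNorm R₀ H₀ 𝔬.blkY hG.lenle 1) (𝔬.D U ∘ₗ 𝔬.G0 U ∘ₗ (𝔬.Qstar U ∘ₗ Cop))
      (fun a b => B₃ * B₃ * c * Real.exp (-((ρ + σ) * g.dist a b))) := by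
    have h := hasMaj_comp_exp htri hG.dnn hrow hB₃ hB₃ hρ₁0 (by linarith) hρ₃ hDQs hCop
    rw [hκ] at h
    simp only [one_mul] at h
    exact (h.congr fun μ => rfl).mono fun a b => le_of_eq (by simp only [toB6_dist])
  have hH1' := hasMaj_left_rightS hG (E := 𝔬.D U) (Fop := 𝔬.Qstar U ∘ₗ Cop) hrow hθ' hB33 hKH hρ (by linarith) hρH hρδ hKD hEF
    (hHop ▸ rH) hfix
  have hH1 : HasMaj (cNorm R₀ H₀ 𝔬.blkZ hG.lenle 2) (cNorm R₀ H₀ 𝔬.blkY hG.lenle 1) (𝔬.D U ∘ₗ Hop)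
      (fun a b => (B₃ * B₃ * c + 𝔖₂.κ * θ' * KH * c) * Real.exp (-(ρ * g.dist a b))) := by
    rw [hHop]; exact hH1'.congr fun μ => rfl
  -- (iii) the Hölder member of (3.133)
  have hkh := hkh_of_state_nbrZ hG 𝔭 hrow hκ hθH hBq hB₃ hKH hΛ hσ hρ (by linarith) hρδ hα1 hβ0 hβ1.le hC hCL1 hCL hST hpQ hCop hKY rHρ hHop hfix
  exact ⟨hH0, hH1, hkh⟩

/-! ## §3 Both blocks of A at one member from the right entries in the state -/

omit [Fintype Z] in
/-- ★★ **THEOREM 3.12 — THE SUP MEMBERS, THE L² BLOCK (3.46) AND THE HÖLDER BLOCK (3.43)–(3.45) OF A ∈ {G, G₁} AT ONE MEMBER, FROM THE REGULAR STATE**: the right entries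
`A : 𝔠⁽⁰⁾ → 𝔖₂`, `A∇\* : 𝔠_Y^{(0)} → 𝔖₁` (A′e^{−ρ_A d}, ρ_A ≧ ρ, ρ + σ ≦ r_R for the readings), `A∇\*_μ : bHX ε → 𝔖₁` (A_I(ε)); the left steps out of 𝔖₂ ∕ 𝔖₁ and their probes;
the sup readings `id : 𝔖₂ → 𝔠^{(−2)}`, `id : 𝔖₁ → 𝔠^{(−1)}` (C_R); Theorem 3.3's (3.42)₂ `he1` and `Thm33G0Dir`, `Thm33G0L2M`; the block-L² bound of T; the transfers; the
co-readings; a uniform constant `Bm` above the three sup-member constants and `KL` above the five L² pieces ⟹ the three printed sup members at `Bm`, `L2Block K (mN·m·Cev·CL²·e^{rρ_f}·KL) ρ_f U`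
(`l2Block_of_members_pairM`) and the Hölder block of `holder_of_state_pairM`. [cite: Balaban1985BackgroundPropagators, Thm 3.12 p.423 + (3.42)–(3.46) pp.397–398 + (3.130) p.421 + (3.138) p.423; Balaban1984PropagatorsII, (2.51)–(2.54) pp.232–233 + Lemma 2.1 (2.60)–(2.61) p.234] -/
theorem blocks_of_state_pairM (hG : GeoOK g) {K : B9.KernelFamily g B} {U : B.Cfg} (𝔬 : Ops g B X Y Z W)
    (𝔭 : HolderProbes g B X Y PX PY) (Dd Dds : B.Cfg → P → Module.End ℝ (X → ℝ)) (bHX : ℝ → BlockNorm (toB6 g R₀ H₀) (X → ℝ))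
    (Rel : g.Site → g.Site → Prop) [DecidableRel Rel] (ev : g.Loc → X → ℝ) (evY : g.Loc → Y → ℝ)
    {𝔖₂ 𝔖₁ : BlockNorm (toB6 g R₀ H₀) (X → ℝ)} {A T : Module.End ℝ (X → ℝ)} {m mN : ℕ}
    {r Cev CL θ' θ₂ A' κb B₀ B₂ CR Bm KL δ₀ δK rR ρ ρA ρf σ α c Λ₁ Λh Λm : ℝ} {θH Bh Bi AI : ℝ → ℝ} {Bi2 : ℝ → ℝ → ℝ}
    (hrow : RowSum (toB6 g R₀ H₀) σ c) (hc : 0 ≤ c)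
    (hθ' : 0 ≤ θ') (hθH : ∀ β, 0 ≤ β → β < 1 → 0 ≤ θH β) (hθ₂ : 0 ≤ θ₂) (hA' : 0 ≤ A') (hAI : ∀ ε, 0 < ε → 0 ≤ AI ε) (hB₀ : 0 ≤ B₀) (hB₂ : 0 ≤ B₂)
    (hCR : 0 ≤ CR) (hBm : 0 ≤ Bm) (hκ2 : 𝔖₂.κ ≤ κb) (hκ1 : 𝔖₁.κ ≤ κb) (hσ : 0 ≤ σ) (hα : 0 ≤ α)
    (hρ : 0 ≤ ρ) (hρS : ρ ≤ δ₀) (hρA : ρ ≤ ρA) (hρδ : ρ + σ ≤ δK) (hρR : ρ + σ ≤ rR) (hq₂ : B₂ * θ₂ * c * c < 1)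
    (hρf : 0 ≤ ρf) (hρf1 : ρf + σ ≤ (1 - α) * ρ) (hρf2 : ρf + 2 * σ + α * ρ ≤ ρ)
    (hBh : ∀ β, 0 ≤ β → β < 1 → 0 ≤ Bh β) (hBi : ∀ ε, 0 < ε → ε ≤ 1 → 0 ≤ Bi ε)
    (hBi2 : ∀ ε β, 0 < ε → ε ≤ 1 → 0 ≤ β → β < 1 → 0 ≤ Bi2 ε β)
    (hΛ₁ : 0 ≤ Λ₁) (hΛm : 0 ≤ Λm)
    (hST1 : ScaleTransfer g ρ α Λ₁ (fun y => g.len y ^ (1 : ℝ)))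
    (hSTh : ScaleTransfer g ρ α Λh (fun y => g.len y ^ (1 / 2 : ℝ)))
    (hSTm : ScaleTransfer g ρ α Λm (fun y => g.len y ^ (-1 : ℝ)))
    (hfix : A = 𝔬.G0 U + 𝔬.G0 U ∘ₗ T ∘ₗ A)
    (he1 : HasMajorantHom (g := toB6 g R₀ H₀) 𝔬.blk 𝔬.blkY (𝔬.D U ∘ₗ 𝔬.G0 U) (fun (a b : g.Site) => B₀ * g.len a * Real.exp (-(δ₀ * g.dist a b))))
    (hH0 : Thm33G0Dir 𝔬 𝔭 Dd Dds R₀ H₀ bHX B₀ Bh Bi Bi2 δ₀ U) (hL2 : Thm33G0L2M 𝔬 Dd Dds R₀ H₀ B₂ δ₀ U)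
    (hT2 : BlockBd (g := toB6 g R₀ H₀) 𝔬.blk 𝔬.blk T (fun (y y' : g.Site) => θ₂ * (g.len y)⁻¹ * (g.len y')⁻¹ * Real.exp (-(δK * g.dist y y'))))
    (rA : HasMaj (cNorm R₀ H₀ 𝔬.blk hG.lenle 0) 𝔖₂ A (fun a b => A' * Real.exp (-(ρA * g.dist a b))))
    (rADs : HasMaj (cNormR R₀ H₀ 𝔬.blkY hG.lenle 0) 𝔖₁ (A ∘ₗ 𝔬.Dstar U) (fun a b => A' * Real.exp (-(ρA * g.dist a b))))
    (rADds : ∀ (μ : P) (ε : ℝ), 0 < ε → HasMaj (bHX ε) 𝔖₁ (A ∘ₗ Dds U μ) (fun a b => AI ε * Real.exp (-(ρA * g.dist a b))))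
    (hRd2 : HasMaj 𝔖₂ (cNormR R₀ H₀ 𝔬.blk hG.lenle (-2)) LinearMap.id (fun a b => CR * Real.exp (-(rR * g.dist a b))))
    (hRd1 : HasMaj 𝔖₁ (cNormR R₀ H₀ 𝔬.blk hG.lenle (-1)) LinearMap.id (fun a b => CR * Real.exp (-(rR * g.dist a b))))
    (hKD : HasMaj 𝔖₂ (cNorm R₀ H₀ 𝔬.blkY hG.lenle 1) (𝔬.D U ∘ₗ 𝔬.G0 U ∘ₗ T) (fun a b => θ' * Real.exp (-(δK * g.dist a b))))
    (hKY : ∀ β : ℝ, 0 ≤ β → β < 1 → HasMaj 𝔖₂ (cNormR R₀ H₀ 𝔭.blkPY hG.lenle (β - 1)) ((𝔭.ΦY U β ∘ₗ 𝔬.D U ∘ₗ 𝔬.G0 U) ∘ₗ T)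
      (fun a b => θH β * Real.exp (-(δK * g.dist a b))))
    (hKDd : ∀ ν : P, HasMaj 𝔖₁ (cNormR R₀ H₀ 𝔬.blk hG.lenle 0) (Dd U ν ∘ₗ 𝔬.G0 U ∘ₗ T) (fun a b => θ' * Real.exp (-(δK * g.dist a b))))
    (hKX : ∀ β : ℝ, 0 ≤ β → β < 1 → HasMaj 𝔖₁ (cNormR R₀ H₀ 𝔭.blkPX hG.lenle (β - 1)) ((𝔭.ΦX U β ∘ₗ 𝔬.G0 U) ∘ₗ T)
      (fun a b => θH β * Real.exp (-(δK * g.dist a b))))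
    (hKXd : ∀ (ν : P) (β : ℝ), 0 ≤ β → β < 1 → HasMaj 𝔖₁ (cNormR R₀ H₀ 𝔭.blkPX hG.lenle β) ((𝔭.ΦX U β ∘ₗ Dd U ν ∘ₗ 𝔬.G0 U) ∘ₗ T)
      (fun a b => θH β * Real.exp (-(δK * g.dist a b))))
    (hBm0 : 𝔖₂.κ * CR * A' * c ≤ Bm) (hBm1 : B₀ + 𝔖₂.κ * θ' * A' * c ≤ Bm) (hBm2 : 𝔖₁.κ * CR * A' * c ≤ Bm)
    (hKL0 : 0 ≤ KL) (hKLa : Bm * Λ₁ ≤ KL) (hKLb : Bm * Λh ≤ KL)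
    (hKL3 : Real.sqrt (Fintype.card (P × P)) * (B₂ + B₂ * (θ₂ * (B₂ * (1 - B₂ * θ₂ * c * c)⁻¹) * c) * c) ≤ KL)
    (hKL3' : Real.sqrt (Fintype.card (P × P)) * (B₂ + B₂ * (θ₂ * (B₂ * (1 - B₂ * θ₂ * c * c)⁻¹) * c) * c) * Λ₁ ≤ KL)
    (hKL5 : Real.sqrt (Fintype.card (P × P)) * (B₂ + B₂ * (θ₂ * (B₂ * (1 - B₂ * θ₂ * c * c)⁻¹) * c) * c) * Λm ≤ KL)
    (hsym : IsTransposePair A A) (htr : IsTransposePair (𝔬.D U ∘ₗ A) (A ∘ₗ 𝔬.Dstar U))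
    (hRd₂ : ∀ a b b', Rel b b' → g.dist a b = g.dist a b')
    (hmult : ∀ y' : g.Site, (Finset.univ.filter (fun y'' => Rel y'' y')).card ≤ m)
    (hnbr : ∀ y : g.Site, (nbr g r y).card ≤ mN)
    (hCL1 : 1 ≤ CL) (hCL : ∀ a a' : g.Site, g.dist a a' ≤ r → g.len a ≤ CL * g.len a') (hCev : 0 ≤ Cev)
    (hl0 : L2ReadsNbr (R := R₀) (H := H₀) K 0 U Rel r Cev 𝔬.blk 𝔬.blk ev A)
    (hl1 : L2ReadsNbr (R := R₀) (H := H₀) K 1 U Rel r Cev 𝔬.blkY 𝔬.blk ev (𝔬.D U ∘ₗ A))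
    (hl2 : L2ReadsNbr (R := R₀) (H := H₀) K 2 U Rel r Cev 𝔬.blk 𝔬.blkY evY (A ∘ₗ 𝔬.Dstar U))
    (hl3 : L2ReadsNbr (R := R₀) (H := H₀) K 3 U Rel r Cev (𝔬.blk ∘ Prod.fst) 𝔬.blk ev (familyOp (fun q : P × P => Dd U q.1 ∘ₗ (A ∘ₗ Dds U q.2))))
    (hl4 : L2ReadsNbr (R := R₀) (H := H₀) K 4 U Rel r Cev (𝔬.blk ∘ Prod.fst) 𝔬.blk ev (familyOp (fun q : P × P => (Dd U q.1 ∘ₗ Dd U q.2) ∘ₗ A)))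
    (hl5 : L2ReadsNbr (R := R₀) (H := H₀) K 5 U Rel r Cev (𝔬.blk ∘ Prod.fst) 𝔬.blk ev (familyOp (fun q : P × P => A ∘ₗ (Dds U q.1 ∘ₗ Dds U q.2))))
    (hH1 : H1ReadsNbr K U 𝔭 Rel r 𝔬.blk 𝔬.blkY ev evY (𝔬.D U ∘ₗ A) (A ∘ₗ 𝔬.Dstar U))
    (hIR : InputReadsFam K U bHX r (𝔬.blk ∘ Prod.fst) (𝔭.blkPX ∘ Prod.fst) (fun β => sliceProbe (𝔭.ΦX U β)) ev
      (familyOp (fun q : P × P => Dd U q.1 ∘ₗ (A ∘ₗ Dds U q.2)))) :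
    (HasMajorant (g := toB6 g R₀ H₀) 𝔬.blk A (fun a b => Bm * g.len a ^ 2 * Real.exp (-(ρ * g.dist a b))) ∧
      HasMajorantHom (g := toB6 g R₀ H₀) 𝔬.blk 𝔬.blkY (𝔬.D U ∘ₗ A) (fun (a b : g.Site) => Bm * g.len a * Real.exp (-(ρ * g.dist a b))) ∧
      HasMajorantHom (g := toB6 g R₀ H₀) 𝔬.blkY 𝔬.blk (A ∘ₗ 𝔬.Dstar U) (fun (a b : g.Site) => Bm * g.len a * Real.exp (-(ρ * g.dist a b)))) ∧
    L2Block K (mN * m * Cev * CL ^ 2 * Real.exp (r * ρf) * KL) ρf U ∧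
    B9.Ineq343_345 K (fun β => m * CL * Real.exp (r * ρf) * (Bh β + κb * θH β * A' * c))
      (fun ε => Real.exp (r * ρf) * (Bi ε + κb * θ' * AI ε * c))
      (fun ε β => CL * Real.exp (r * ρf) * (Bi2 ε β + κb * θH β * AI (β + ε) * c)) ρf U := by
  -- (3.42)₁,₂,₃ at the uniform constant Bm
  have hm0 := entry0_of_stateS hG hrow hc hA' hCR hρ hρA hρR rA hRd2
  have hm1 := entry1_of_stateS hG hrow hc hθ' hB₀ hA' hρ hρS hρA hρδ he1 hKD rA hfix
  have hm2 := entry2_of_stateS hG hrow hc hA' hCR hρ hρA hρR rADs hRd1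
  have hM0 : HasMajorant (g := toB6 g R₀ H₀) 𝔬.blk A (fun a b => Bm * g.len a ^ 2 * Real.exp (-(ρ * g.dist a b))) :=
    hasMajorant_mono (g := toB6 g R₀ H₀) 𝔬.blk hm0 fun a b =>
      mul_le_mul_of_nonneg_right (mul_le_mul_of_nonneg_right hBm0 (sq_nonneg _)) (Real.exp_nonneg _)
  have hM1 : HasMajorantHom (g := toB6 g R₀ H₀) 𝔬.blk 𝔬.blkY (𝔬.D U ∘ₗ A) (fun (a b : g.Site) => Bm * g.len a * Real.exp (-(ρ * g.dist a b))) :=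
    hasMajorantHom_mono (g := toB6 g R₀ H₀) 𝔬.blk 𝔬.blkY hm1 fun a b =>
      mul_le_mul_of_nonneg_right (mul_le_mul_of_nonneg_right hBm1 (hG.lenle a)) (Real.exp_nonneg _)
  have hM2 : HasMajorantHom (g := toB6 g R₀ H₀) 𝔬.blkY 𝔬.blk (A ∘ₗ 𝔬.Dstar U) (fun (a b : g.Site) => Bm * g.len a * Real.exp (-(ρ * g.dist a b))) :=
    hasMajorantHom_mono (g := toB6 g R₀ H₀) 𝔬.blkY 𝔬.blk hm2 fun a b =>
      mul_le_mul_of_nonneg_right (mul_le_mul_of_nonneg_right hBm2 (hG.lenle a)) (Real.exp_nonneg _)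
  have hρK : ρ ≤ δK := by linarith
  have hl2B := l2Block_of_members_pairM hG 𝔬 Dd Dds Rel ev evY hrow hBm hBm hθ₂ hB₂ hσ hα hρ hρS hρK hq₂ hρf hρf1 hρf2 hΛ₁ hΛm hST1 hSTh hSTm
    hfix hM0 hM1 hM2 hL2 hT2 hsym htr hKL0 hKLa hKLb hKL3 hKL3' hKL5 hRd₂ hmult hnbr hCL1 hCL hCev hl0 hl1 hl2 hl3 hl4 hl5
  have hρfρ : ρf ≤ ρ := by
    have hαρ : 0 ≤ α * ρ := mul_nonneg hα hρ
    linarith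
  have hHo := holder_of_state_pairM hG 𝔬 𝔭 Dd Dds bHX Rel ev evY hrow hc hθ' hθH hA' hAI hκ2 hκ1 hρ hρS hρA hρδ hρf hρfρ hBh hBi hBi2 hfix hH0
    rA rADs rADds hKY hKDd hKX hKXd hRd₂ hmult hCL1 hCL hH1 hIR
  exact ⟨⟨hM0, hM1, hM2⟩, hl2B, hHo⟩

/-! ## §4 The H-words weakened to uniform constants (the shape the member-level top assembly consumes) -/

omit [Fintype PX] [Fintype P] [DecidableEq g.Site] in
/-- **THE H-WORDS OF `hwords_of_state` AT UNIFORM CONSTANTS**: given `BH` above the two sup-word constants and a family `Cβ` above the Hölder constants, and a rate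
`δ₁` with `δ₁ ∕ 2 ≦ (1 − α)ρ`: the two sup words at `BH·e^{−ρd}` and the Hölder member of (3.133) at `Cβ(β)` and the rate `δ₁ ∕ 2` — the `hmemH` ∕ `hres` inputs of
`B9Thm312WholeLeafRelHZM.thm312Printed_of_membersRelHZ`. [cite: Balaban1985BackgroundPropagators, (3.126) p.420 + (3.129) p.421 + (3.133) p.422 + Thm 3.12 p.423] -/
theorem hwords_uniform_of_state (hG : GeoOK g) {Hk : B9.HKernel g B} {U : B.Cfg} {d : ℕ} {PL : g.Loc → Prop} (S : ModelSignsOn g PL)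
    (𝔬 : Ops g B X Y Z W) (𝔭 : HolderProbes g B X Y PX PY)
    {bZ : BlockNorm (toB6 g R₀ H₀) (Z → ℝ)} {𝔖₂ : BlockNorm (toB6 g R₀ H₀) (X → ℝ)} {A T : Module.End ℝ (X → ℝ)} {Cop : Module.End ℝ (Z → ℝ)}
    {Hop : (Z → ℝ) →ₗ[ℝ] (X → ℝ)} {r CL θ' KH CR B₃ BH δ₃ δK rR ρ ρH δ₁ α Λ σ c : ℝ} {θH Bq Cβ : ℝ → ℝ}
    (hrow : RowSum (toB6 g R₀ H₀) σ c) (hκ : bZ.κ = 1) (hc : 0 ≤ c) (hθ' : 0 ≤ θ') (hθH : ∀ β, 0 ≤ β → β < 1 → 0 ≤ θH β) (hKH : 0 ≤ KH) (hCR : 0 ≤ CR)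
    (hB₃ : 0 ≤ B₃) (hBq : ∀ β, 0 ≤ Bq β) (hΛ : 0 ≤ Λ) (hσ : 0 ≤ σ) (hρ : 0 ≤ ρ) (hρH : ρ ≤ ρH) (hρR : ρ + σ ≤ rR) (hρ₃ : ρ + σ + σ ≤ δ₃) (hρδ : ρ + σ ≤ δK)
    (hα1 : α ≤ 1) (hδ₁ : δ₁ / 2 ≤ (1 - α) * ρ)
    (hBH0 : 𝔖₂.κ * CR * KH * c ≤ BH) (hBH1 : B₃ * B₃ * c + 𝔖₂.κ * θ' * KH * c ≤ BH)
    (hCβ : ∀ β, 0 ≤ β → β < 1 → CL ^ 2 * Real.exp (r * ((1 - α) * ρ)) * ((Bq β * B₃ * c + 𝔖₂.κ * θH β * KH * c) * Λ) ≤ Cβ β)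
    (hCβ0 : ∀ β, 0 ≤ Cβ β)
    (hHop : Hop = A ∘ₗ (𝔬.Qstar U ∘ₗ Cop)) (hfix : A = 𝔬.G0 U + 𝔬.G0 U ∘ₗ T ∘ₗ A)
    (rH : HasMaj (cNorm R₀ H₀ 𝔬.blkZ hG.lenle 2) 𝔖₂ Hop (fun a b => KH * Real.exp (-(ρH * g.dist a b))))
    (hRd : HasMaj 𝔖₂ (cNormR R₀ H₀ 𝔬.blk hG.lenle (-2)) LinearMap.id (fun a b => CR * Real.exp (-(rR * g.dist a b))))
    (hKD : HasMaj 𝔖₂ (cNorm R₀ H₀ 𝔬.blkY hG.lenle 1) (𝔬.D U ∘ₗ 𝔬.G0 U ∘ₗ T) (fun a b => θ' * Real.exp (-(δK * g.dist a b))))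
    (hKY : ∀ β, 0 ≤ β → β < 1 → HasMaj 𝔖₂ (cNormR R₀ H₀ 𝔭.blkPY hG.lenle (β - 1)) ((𝔭.ΦY U β ∘ₗ 𝔬.D U ∘ₗ 𝔬.G0 U) ∘ₗ T)
      (fun a b => θH β * Real.exp (-(δK * g.dist a b))))
    (hDQs : HasMaj bZ (cNorm R₀ H₀ 𝔬.blkY hG.lenle 1) (𝔬.D U ∘ₗ 𝔬.G0 U ∘ₗ 𝔬.Qstar U) (fun a b => B₃ * Real.exp (-(δ₃ * g.dist a b))))
    (hCop : HasMaj (cNorm R₀ H₀ 𝔬.blkZ hG.lenle 2) bZ Cop (fun a b => B₃ * Real.exp (-(δ₃ * g.dist a b))))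
    (hpQ : ∀ β, 0 ≤ β → β < 1 → HasMaj bZ (cNormR R₀ H₀ 𝔭.blkPY hG.lenle (β - 1)) ((𝔭.ΦY U β ∘ₗ 𝔬.D U ∘ₗ 𝔬.G0 U) ∘ₗ 𝔬.Qstar U)
      (fun a b => Bq β * Real.exp (-(δ₃ * g.dist a b))))
    (hC : CoReadsHHolderNbr Hk U d 𝔭 r 𝔬.blkZ (𝔬.D U ∘ₗ Hop))
    (hCL1 : 1 ≤ CL) (hCL : ∀ a a' : g.Site, g.dist a a' ≤ r → g.len a ≤ CL * g.len a')
    (hST : ScaleTransfer g ρ α Λ (fun y => g.len y ^ (2 : ℝ))) :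
    (HasMaj (cNorm R₀ H₀ 𝔬.blkZ hG.lenle 2) (cNorm R₀ H₀ 𝔬.blk hG.lenle 2) Hop (fun a b => BH * Real.exp (-(ρ * g.dist a b))) ∧
      HasMaj (cNorm R₀ H₀ 𝔬.blkZ hG.lenle 2) (cNorm R₀ H₀ 𝔬.blkY hG.lenle 1) (𝔬.D U ∘ₗ Hop) (fun a b => BH * Real.exp (-(ρ * g.dist a b)))) ∧
    ∀ (β : ℝ) (ζ : g.Cut) (y y' : g.Site), 0 ≤ β → β < 1 → g.cutInT ζ y →
      Hk.h U β ζ y' ≤ Cβ β * g.cutH β ζ * (g.len y) ^ (-(1 + β)) * (g.len y') ^ (-(d : ℝ)) * Real.exp (-(δ₁ / 2 * g.dist y y')) := by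
  have hW := fun β (h0 : 0 ≤ β) (h1 : β < 1) => hwords_of_state hG 𝔬 𝔭 hrow hκ hc hθ' (hθH β h0 h1) hKH hCR hB₃ (hBq β) hΛ hσ hρ hρH hρR hρ₃ hρδ hα1 h0 h1
    hHop hfix rH hRd hKD (hKY β h0 h1) hDQs hCop (hpQ β h0 h1) hC hCL1 hCL hST
  obtain ⟨hH0, hH1, -⟩ := hW 0 le_rfl zero_lt_one
  refine ⟨⟨hH0.mono fun a b => mul_le_mul_of_nonneg_right hBH0 (Real.exp_nonneg _),
    hH1.mono fun a b => mul_le_mul_of_nonneg_right hBH1 (Real.exp_nonneg _)⟩, fun β ζ y y' h0 h1 hζ => ?_⟩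
  refine ((hW β h0 h1).2.2 ζ y y' hζ).trans ?_
  have hrate : Real.exp (-((1 - α) * ρ * g.dist y y')) ≤ Real.exp (-(δ₁ / 2 * g.dist y y')) :=
    Real.exp_le_exp.mpr (neg_le_neg (mul_le_mul_of_nonneg_right hδ₁ (hG.dnn y y')))
  have hnn : 0 ≤ g.cutH β ζ * (g.len y) ^ (-(1 + β)) * (g.len y') ^ (-(d : ℝ)) :=
    mul_nonneg (mul_nonneg (S.cutH_nonneg β ζ) (Real.rpow_nonneg (hG.lenle y) _)) (Real.rpow_nonneg (hG.lenle y') _)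
  calc CL ^ 2 * Real.exp (r * ((1 - α) * ρ)) * ((Bq β * B₃ * c + 𝔖₂.κ * θH β * KH * c) * Λ) * g.cutH β ζ * (g.len y) ^ (-(1 + β)) *
        (g.len y') ^ (-(d : ℝ)) * Real.exp (-((1 - α) * ρ * g.dist y y'))
      = CL ^ 2 * Real.exp (r * ((1 - α) * ρ)) * ((Bq β * B₃ * c + 𝔖₂.κ * θH β * KH * c) * Λ) *
        (g.cutH β ζ * (g.len y) ^ (-(1 + β)) * (g.len y') ^ (-(d : ℝ))) * Real.exp (-((1 - α) * ρ * g.dist y y')) := by ring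
    _ ≤ Cβ β * (g.cutH β ζ * (g.len y) ^ (-(1 + β)) * (g.len y') ^ (-(d : ℝ))) * Real.exp (-(δ₁ / 2 * g.dist y y')) :=
      mul_le_mul (mul_le_mul_of_nonneg_right (hCβ β h0 h1) hnn) hrate (Real.exp_nonneg _) (mul_nonneg (hCβ0 β) hnn)
    _ = Cβ β * g.cutH β ζ * (g.len y) ^ (-(1 + β)) * (g.len y') ^ (-(d : ℝ)) * Real.exp (-(δ₁ / 2 * g.dist y y')) := by ring

end

end Literature.MathematicalPhysics.QuantumFieldTheory.Balaban1983to89.B9Thm312WholeLeafBlocksRegular
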